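import Summits.BirchSwinnertonDyer.BirchSwinnertonDyer.Theorems.EdixhovenFibreFiveSevenStarredOptimalManinUnitFiveSevenLocalFormulaOrdinaryCells
import Summits.BirchSwinnertonDyer.BirchSwinnertonDyer.Theorems.EdixhovenFibreFiveSevenStarredOptimalManinUnitFiveSevenLocalFormulaSupersingularCells
import Summits.BirchSwinnertonDyer.BirchSwinnertonDyer.Theorems.EdixhovenFibreFiveSevenStarredOptimalManinUnitFiveSevenDokchitserDokchitser
import HarnessLib

/-! # Line `kato-lever` — skeleton v12 for crux K★ `StarredOptimalManinUnitFiveSeven`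

v12 (LEAD g32, 2026-08-31): THREE of the four v11 stubs are LANDED BY NAME — `stub_localFormulaSupersingularCells` (p789571,
`…Theorems.StarredOptimalManinUnitFiveSevenLocalFormulaSupersingularCells`), `stub_dokchitserDokchitser` (p793225, `…DokchitserDokchitser`),
`stub_localFormulaOrdinaryCells` (p801055, `…LocalFormulaOrdinaryCells`, edix-p4 g30: `ordinaryCapstone` ∘ the unit-root frame, with (N1″) p798323 for `hne`);
they are IMPORTED here and no longer stubs. The ONE remaining stub is P1-bar `stub_sl2NeronValues` (print XL, Kato 2004); the composition is the landed
conditional closer `…LocalFormulaOrdinaryCells.starredOptimalManinUnitFiveSeven_of_sl2NeronValuesBar : P1-bar → K★` BY NAME. K★ ⟸ {P1-bar}; BSD is not proved.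
(stmt-BirchSwinnertonDyer-22226, route EdixhovenFibreFiveSeven), seat bsd-line-edix-p1 g0 / g11 / g17 / g18 / g29 / g30 (2026-08-30).

v11 (g30): = v10 with the inline `--` comments removed from the two LOC stub statements (the gate's one-line signature normalisation
turns them into a comment swallowing the rest of the signature, so no `--supports` proof could match v10's stubs by name + signature).

v10 (g30, «ALTERNATING TOWER»): the Weil towers handed to the two LOCAL stubs now carry a SEVENTH law, levelwise alternation
`e_k(S, S) = 1` (binder `_halt`) — what the (K₂)^ram road consumes as `healt` / `heL` / `henondeg` (`PAdicHodge.WeilTowerAlternating/Nondegenerate`);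
threaded from the bridge (`…RecTowerAtBridgeAlt`, seven-law tower `exists_weilPairing_torsionMul_tower_alt`) through `…CellsOfRecTowerAtIntrinsicAlt` and the
sockets `…RecTowerCellsOfLocalFormulaAlt`. Otherwise = v9.

v9 (g30, «LOCAL SOCKETS»): the two intrinsic REC stubs of v8 — Kato's explicit reciprocity law at the cell curves AND the cyclotomic
towers `ℚ_v ⊆ ℚ(ζ_m)_w` (a two-level statement with line-datum compatibility, descent and Galois averaging inside) — are REPLACED by the
purely LOCAL statements they follow from (tree theorems `…RecTowerCellsOfLocalFormula.recTowerSupersingularCells_of_localFormula` /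
`…recTowerOrdinaryCells_of_localFormula`, LEAD g30, on top of the K′-package `…RecTowerAtCyclotomicOverExt/OverCompletion`, the K-data
`…RecTowerKData` and the from-above theorem): `stub_localFormulaSupersingularCells` / `stub_localFormulaOrdinaryCells` = KATO'S FORMULA
`⟨[η″], P′⟩ = Tr_{K_{v′}/ℚ_p}(c′ · exp*_{d″}(η″) · log_{ω′} P′)` (`∀ d″ ∃ c′`) for the DIRECT representation `V_pW′|_{Γ_{K_{v′}}}` of the cell
curve `W′/ℚ` itself over the completion `K_{v′}` of ANY number field `K ∋ p^{1/e}` (`e` from the cell table) at ANY place `v′ ∋ p`, with the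
packet keys, any compatible `ω′`, the Weil tower of `W′` and the Prop-1.2.3 binders of the direct representation handed over. No tower, no
cyclotomic level, no descent is left in the stubs; the supersingular socket is the exact output shape of the (K₂)^ram road
(`…TransportedReciprocityAllPoints` ∘ T5-E transport ∘ per-cell model data). K★ stays OPEN ⟸ {P1-bar, DD, LOC@ord-cells, LOC@ss-cells};
BSD is not proved by any of this.

v8 (g29, later the same day, «INTRINSIC STUBS»): the two REC stubs of v7 asked Kato's reciprocity law for every MEMBER `W′ ∼ W` of the
class of a cell curve `W` (P1-bar's member is known only up to isogeny); v8 makes them INTRINSIC — for every globally minimal `W′/ℚ` that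
ITSELF satisfies the cell conditions — and moves the cell data from `W` to Kato's member inside the composition
(`…CellDataOfIsogenous.cellData_of_isIsogenous`: `Addv`/`Irr`/no-`Iₙ*` transports + Dokchitser–Dokchitser 2015 Thm. 5.1 (1) for `ord_p Δ_min`
along a prime-to-`p` cyclic isogeny), at the price of ONE more cite-only published stub `stub_dokchitserDokchitser` (already a conjunct of this
route's `PublishedManinFacts` / `KPTransportInputs`). Composition = `…CellsOfRecTowerAtIntrinsic.starredOptimalManinUnitFiveSeven_of_recTowerAtIntrinsic`.
K★ stays OPEN ⟸ {P1-bar, DD, REC@ord-cells (intrinsic), REC@ss-cells (intrinsic)}; BSD is not proved by any of this.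

v7 (g29, «SEAM CLOSED»): the stub [REC-tower] of v6 — the cite-only fact `tatePairingPoint_eq_trace_expStar_log_tower`, Kato's explicit
reciprocity law for EVERY elliptic curve over EVERY field of characteristic `0` at EVERY tower of `p`-adic fields — is REPLACED by the two
statements the line actually constructs and K★ actually consumes (memo `Lines/kato-lever-K3-H5-endpoint.md` §3 «SEAM», memo
`Lines/kato-lever-seam-rec-at-cells.md`): the BODY of [REC-tower] at `K₀ = ℚ`, the globally minimal members `W′ ∼ W` of the isogeny class of a
curve `W` IN A K★ CELL, and the cyclotomic towers `ℚ_v ⊆ ℚ(ζ_m)_w` (`v = (p)`, `p ∤ m`, `w ∣ p`) —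
* `stub_recTowerOrdinaryCells` on the three (G)-ORDINARY starred cells `(5; III*), (7; IV*), (7; II*)` (`p = 5 ↔ ord_p Δ_min = 9`);
* `stub_recTowerSupersingularCells` on the three potentially SUPERSINGULAR cells `(5; IV*), (5; II*), (7; III*)`.
Both follow from v6's stub (`…RecTowerAtBridge.recTowerAt_cyclotomic_of_reciprocityLaw`), so v7 is not weaker than v6; the composition is the
tree theorem `…CellsOfRecTowerAt.starredOptimalManinUnitFiveSeven_of_recTowerAt_of_sl2NeronValuesBar` (the consumer chain of hT₂ re-keyed per
curve / per tower: p780839 `…TowerRangeAt`, p781357 `…SemiLocalIntegralityOfRangeAt`, `…AssemblyAtBarOfRangeAt`, `…RecTowerAtBridge`,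
`…CellsOfRecTowerAt`, all LEAD g29). What produces the new stubs: the (K₂)^ram road (T5-B/C, edix-p4) gives Kato's formula over the cells' fields
of good reduction `K' ⊇ ℚ(ζ_m)_w`; `…ReciprocityTowerFromAbove.exists_const_tower_clauses_of_formula_above` (g23) descends it to exactly the
body of [REC-tower] at the Galois tower `ℚ_v ⊆ ℚ(ζ_m)_w`; the supersingular stub is that road's target, the ordinary stub needs the ordinary
analogue (E₀ ordinary: unit-root splitting instead of `φ² = −p`). P1-bar unchanged (print XL). K★ stays OPEN ⟸ {P1-bar, REC@ord-cells,
REC@ss-cells}; BSD is not proved by any of this.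

v6 (g18): hT₂ no longer a stub (`expStarTower_of_stub` = `exists_smul_range_expStarCoord_tower_iff_trace_log_of_reciprocityLaw stub_reciprocityLaw`,
p700964); stubs {P1-bar, [REC-tower]}. v5 (g18): P1 print-faithful (`…_bar`). v4 (g17): hDR discharged on the cells. v3 (g11): F″ ⟸ {P1, hT₂, hDR}.
v2 (g0/g4): K★ ⟸ F″ + LEVER″ (p580937, p581141).

IDEA (unchanged). Manin's `p`-part at the `X₀(N)`-optimal curve of STARRED additive type IV*, III*, II* at `p ∈ {5, 7}`, `E[p]` irreducible,
through KATO'S EULER SYSTEM read in Néron units: integrality of the twisted modular-symbol sums against `|Ω^±(W)|` for all tame `χ` of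
conductor `m`, `p ∤ m` ⟹ `p ∤ c` at a lattice-optimal datum; the `p`-adic input is the range of `exp*` = trace dual of `log_ω` at the towers
`ℚ_p ⊆ ℚ(ζ_m)_w` — i.e. Kato's reciprocity law THERE, for the members of the class. -/

set_option autoImplicit false
set_option linter.dupNamespace false

noncomputable section

namespace Summit.BirchSwinnertonDyer.BirchSwinnertonDyer.Cruxes.StarredOptimalManinUnitFiveSeven.KatoLever

/-- **Stub P1-bar — Kato's `SL₂(ℤ)`-type zeta-element values in the Néron coordinate, print-faithful** (PUBLISHED; the tree's cite-only fact
`Kato2004.exists_member_sl2ZetaElement_neron_values_bar`, p697548). XL formalisation target (the Euler system itself).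
[cite: Kato2004Asterisque, Thm. 6.6 (1) (p. 163), (8.1.3) (p. 180), Thm. 9.7 (p. 189)] -/
theorem stub_sl2NeronValues :
    Literature.NumberTheory.EllipticCurves.Kato2004.exists_member_sl2ZetaElement_neron_values_bar := by
  sorry

/-- **The composition ⟹ K★ BY NAME** (no sorry of its own): the landed conditional closer
`…LocalFormulaOrdinaryCells.starredOptimalManinUnitFiveSeven_of_sl2NeronValuesBar` (= g30's `…OfOrdinaryLocalFormula` ∘ the landed stubs
LOC@ord p801055, LOC@ss p789571, DD p793225) applied to the one remaining stub P1-bar. [cite: Kato2004Asterisque, (8.1.3) (p. 180), Thm. 9.7 (p. 189)]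
[cite: Kato1993LNM1553, Ch. II Thm. 1.4.1 (4)] -/
theorem StarredOptimalManinUnitFiveSeven_of :
    Summit.BirchSwinnertonDyer.BirchSwinnertonDyer.Theses.EdixhovenFibreFiveSeven.StarredOptimalManinUnitFiveSeven :=
  Summit.BirchSwinnertonDyer.BirchSwinnertonDyer.Theorems.StarredOptimalManinUnitFiveSevenLocalFormulaOrdinaryCells.starredOptimalManinUnitFiveSeven_of_sl2NeronValuesBar
    stub_sl2NeronValues

end Summit.BirchSwinnertonDyer.BirchSwinnertonDyer.Cruxes.StarredOptimalManinUnitFiveSeven.KatoLever
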